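import Summits.BirchSwinnertonDyer.BirchSwinnertonDyer.Theorems.ClassRecordThreeEulerHalvesAtThreeCartanCoverAssembly
import Summits.BirchSwinnertonDyer.BirchSwinnertonDyer.Theorems.ClassRecordThreeEulerHalvesAtThreeCartanCoverHeckePeriods
import Summits.BirchSwinnertonDyer.BirchSwinnertonDyer.Theorems.ClassRecordThreeEulerHalvesAtThreeCartanCoverEisenstein
import Literature.NumberTheory.Automorphic.ShimuraCurveCartanLevelHeckeDegree
import Literature.NumberTheory.EllipticCurves.ModPReducibilityAlmostAllProofs
import Literature.NumberTheory.EllipticCurves.LFunctionPrimeCoeff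
import Literature.NumberTheory.EllipticCurves.ComplexMultiplicationLFunctionIsogenyHoldsProofs
import HarnessLib

/-!
# Crux NUM `CartanOnePlaceDegreeLawAtThree` (item 24801), line `lattice` — brick 3: the descent clause (D3) `CartanCover.DescentNonsplitAtThree`
# is a THEOREM modulo two PRINT facts (Hecke degree `ℓ + 1`; degree of a parametrisation with `n`-divisible periods)

Seat `bsd-stepL-tam3-p1` g27 (LEAD of crux 24801; `--supports stmt-BirchSwinnertonDyer-24801 --as helper`). THE ARGUMENT (new; replaces the Galois
descent `E[3](ℚ(μ_q^∞)) = 0` of NUM-PROOF-SKETCH rev 3 Prop. L1 by Hecke algebra): let `Q` be class-minimal for `V` on `X_{(D,M;C)}`, `F = Q.form`,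
`Λ = Λ(W₁)`, `q ∈ C`, and suppose the docked vector `u_C` is `3w` with `w ∈ 𝕃` (the period lattice). (1) The component of `u_C` at `1` is `F|_{Γ̄(q)}`,
so every `Γ̄(q)`-period of `F` lies in `3Λ` (`periods_mem_of_dockedVector_eq`). (2) EISENSTEIN STEP: for a good prime `ℓ` (`ℓ ∤ N`), bricks 1–2
(`HeckePeriod.period_smul_eq_sum`, `Eisenstein.card_smul_period_sub_sum_mem`) with `T_ℓ F = a_ℓ(W₁) F` (`Q.hecke_eq`) and `#(Γ∖ι(O(ℓ))) = ℓ + 1`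
(PRINT: `cartanLevel_card_heckeCosets_eq`) give `(a_ℓ(W₁) − ℓ − 1) · ∫^γ F ∈ 3Λ` for every `γ ∈ Γ`. (3) `a_ℓ(W₁) = a_ℓ(V)` (tree
`LFunction_eq_of_isIsogenous_holds`, Knapp 11.67) and `E[3]` irreducible (`ClassX11b`) forbid `a_ℓ(V) ≡ ℓ + 1 (mod 3)` for all good `ℓ` (tree
`not_irreducible_of_frobeniusTrace_congr_off_finite`, DDT Prop. 2.6); at a good `ℓ` with `3 ∤ a_ℓ − ℓ − 1`, Bezout gives `∫^γ F ∈ 3Λ` for ALL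
`γ ∈ Γ`. (4) Then `F∕3` parametrises `W₁` with degree `Q.deg ∕ 9 < Q.deg` (PRINT: `cartanParametrizationData_deg_of_periods_mul`), contradicting
class-minimality. Hence `descentNonsplit_of_facts : cartanLevel_card_heckeCosets_eq → cartanParametrizationData_deg_of_periods_mul → DescentNonsplitAtThree`.
REMARKS. The hypotheses `Surj V 3`, `q ≠ 3`, `q² ∥ N`, `3 ∣ c_q` of (D3) are not used (only `Irr V 3`); at `q ≡ 1 (3)` the conclusion is in
fact automatic (the torus quotient has order prime to `3`), but the proof is uniform. For the registered skeleton this turns the CONTENT stub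
`stub_descentNonsplitAtThree` of `Lines/lattice.lean` v2 into «cite ∧ PROVED» (VARIANT-N: two print conjuncts join the cite stub; v3 turnkey by
the LEAD). HONEST: conditional on two named print facts (Literature `ShimuraCurveCartanLevelHeckeDegree`); nothing about NUM, (F2b♮), D4, 23422,
19109 or any curve's BSD is proved; BSD is proved for no curve. [cite: Mazur1977, §II.11] [cite: DarmonDiamondTaylor1995, Prop. 2.6 (b) and Prop. 2.11 (a)]
[cite: ShimuraIATAF1971, §8.3 (8.3.2)] [cite: KohenPacetti2016, Rem. 3.8 (arXiv:1403.7801v3 p. 15)]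
-/

set_option linter.dupNamespace false
set_option autoImplicit false

noncomputable section

open scoped MatrixGroups ModularForm
open UpperHalfPlane

namespace Summit.BirchSwinnertonDyer.BirchSwinnertonDyer.Theorems.CartanCover.Descent

open Literature.NumberTheory.Automorphic Literature.NumberTheory.EllipticCurves
open Summit.BirchSwinnertonDyer.Rank1Residual

variable {D M : ℕ} {C : Finset ℕ} {X : CartanLevelCurveData D M C} {q : ℕ}

/-! ## §1 From `u_C = 3w` to `Γ̄(q)`-periods in `3Λ` -/

/-- Scalar multiples pass through segment integrals on `Γ̄(q)`: `∫_z^w (c·G) = c ∫_z^w G`. [folklore] -/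
theorem segmentIntegral_smul_principalLevel (G : CuspForm (principalLevel X q) 2) (c : ℂ) (z w : ℍ) :
    segmentIntegral (⇑(c • G)) z w = c * segmentIntegral G z w := by
  obtain ⟨H, hH⟩ := exists_hasDerivAt_primitive G
  have hH' : ∀ u : ℂ, 0 < u.im → HasDerivAt (fun v => c * H v) ((c • G) (ofComplex u)) u := by
    intro u hu
    rw [CuspForm.IsGLPos.smul_apply, smul_eq_mul]
    exact (hH u hu).const_mul c
  rw [segmentIntegral_eq_sub (c • G) hH' z w, segmentIntegral_eq_sub G hH z w]
  ring

/-- **If the docked vector `u_C` of `F` is `3w` with `w` in the period lattice `𝕃(u_C, Λ)`, then every `Γ̄(q)`-period of `F` is `3` times an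
element of `Λ`** (component at `1`: `u_C(1) = F|_{Γ̄(q)}` and `w(1)` has its `Γ̄(q)`-periods in `Λ`). -/
theorem periods_mem_of_dockedVector_eq [Fact q.Prime] (R : CoverReduction X q) (hq : q ∈ C) (F : CuspForm X.Gamma 2) (Λ : Submodule ℤ ℂ)
    (hF : HasPeriodsIn X.Gamma (⇑F) (Λ : Set ℂ)) (w : R.periodLattice Λ (R.dockNonsplit hq F))
    (hw : R.dockedVector hq F Λ hF = (3 : ℤ) • w) {g : GL (Fin 2) ℝ} (hg : g ∈ principalLevel X q) (z : ℍ) :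
    ∃ y ∈ Λ, segmentIntegral F z (g • z) = 3 * y := by
  -- the component at `1`
  have h1 : ((R.dockedVector hq F Λ hF : R.periodLattice Λ (R.dockNonsplit hq F)) : R.IndCuspForm).1 1 =
      (((3 : ℤ) • w : R.periodLattice Λ (R.dockNonsplit hq F)) : R.IndCuspForm).1 1 := by rw [hw]
  rw [R.dockedVector_apply_one hq F Λ hF] at h1
  have hcoe : (((3 : ℤ) • w : R.periodLattice Λ (R.dockNonsplit hq F)) : R.IndCuspForm) = ((3 : ℤ) : ℂ) • (w : R.IndCuspForm) := by
    rw [AddSubgroupClass.coe_zsmul]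
    exact (Int.cast_smul_eq_zsmul ℂ (3 : ℤ) (w : R.IndCuspForm)).symm
  have h2 : (((3 : ℤ) • w : R.periodLattice Λ (R.dockNonsplit hq F)) : R.IndCuspForm).1 1 = ((3 : ℤ) : ℂ) • ((w : R.IndCuspForm).1 1) := by
    rw [hcoe, Submodule.coe_smul, Pi.smul_apply]
  have hfun : (⇑F : ℍ → ℂ) = ⇑((((3 : ℤ) : ℂ)) • ((w : R.IndCuspForm).1 1)) := by
    rw [← h2, ← h1, coe_restrictGamma]
  -- periods of `w(1)` on `Γ̄(q)` lie in `Λ`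
  have hwper : HasPeriodsIn (principalLevel X q) (⇑((w : R.IndCuspForm).1 1)) (Λ : Set ℂ) :=
    ((R.mem_periodLattice_iff Λ _ _).mp w.2).2 1
  refine ⟨segmentIntegral ((w : R.IndCuspForm).1 1) z (g • z), hwper g hg z, ?_⟩
  rw [hfun, segmentIntegral_smul_principalLevel]
  push_cast
  ring

/-! ## §2 Bezout: `m · x ∈ 3Λ`, `x ∈ Λ`, `3 ∤ m` ⟹ `x ∈ 3Λ` -/

/-- If `x ∈ Λ`, `m x = 3 y` with `y ∈ Λ` and `3 ∤ m`, then `x = 3 x'` with `x' ∈ Λ`. [folklore] -/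
theorem exists_eq_three_mul_of_coprime (Λ : Submodule ℤ ℂ) {x y : ℂ} (hx : x ∈ Λ) (hy : y ∈ Λ) {m : ℤ} (hm : ¬ (3 : ℤ) ∣ m)
    (hxy : (m : ℂ) * x = 3 * y) : ∃ x' ∈ Λ, x = 3 * x' := by
  have hcop : IsCoprime m 3 := (Int.prime_three.irreducible.coprime_iff_not_dvd.mpr hm).symm
  obtain ⟨u, v, huv⟩ := hcop
  refine ⟨u • y + v • x, Λ.add_mem (Λ.smul_mem u hy) (Λ.smul_mem v hx), ?_⟩
  have huv' : ((u * m + v * 3 : ℤ) : ℂ) = 1 := by rw [huv, Int.cast_one]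
  rw [zsmul_eq_mul, zsmul_eq_mul]
  calc x = ((u * m + v * 3 : ℤ) : ℂ) * x := by rw [huv', one_mul]
    _ = (u : ℂ) * ((m : ℂ) * x) + 3 * ((v : ℂ) * x) := by push_cast; ring
    _ = 3 * ((u : ℂ) * y + (v : ℂ) * x) := by rw [hxy]; ring

/-! ## §3 (D3) from the two print facts -/

/-- **(D3) `DescentNonsplitAtThree` FROM PRINT FACTS**: the Hecke degree `ℓ + 1` on Cartan-level curves (`cartanLevel_card_heckeCosets_eq`) and the
degree of a parametrisation with `n`-divisible periods (`cartanParametrizationData_deg_of_periods_mul`) imply that the docked class-minimal form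
`u_C` is not divisible by `3` in its period lattice — through the Eisenstein congruence (bricks 1–2), `a_ℓ(W₁) = a_ℓ(V)` (Knapp 11.67, tree) and
`E[3]` irreducible ⟹ `a_ℓ(V) ≢ ℓ + 1 (mod 3)` for some good `ℓ` (DDT Prop. 2.6, tree). [cite: Mazur1977, §II.11] [cite: DarmonDiamondTaylor1995, Prop. 2.6 (b)] -/
theorem descentNonsplit_of_facts (hHD : cartanLevel_card_heckeCosets_eq) (hISO : cartanParametrizationData_deg_of_periods_mul) :
    DescentNonsplitAtThree := by
  intro V _ _ hX _hS N D M C q _ X W₁ _ Q hq R hN hDMC _hq3 _hq3N _hc hQ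
  rintro ⟨w, hw⟩
  classical
  have hIrr : V.HasIrreducibleModPGaloisRep 3 := hX.2.2.2
  -- the finite exceptional set: the prime divisors of `N`
  have hN0 : N ≠ 0 := by rw [← hN]; exact (V.conductorNorm_pos_holds).ne'
  set S : Set ℕ := {ℓ | ℓ ∣ N} with hSdef
  have hSfin : S.Finite := (Set.finite_le_nat N).subset fun ℓ hℓ => Nat.le_of_dvd (Nat.pos_of_ne_zero hN0) hℓ
  refine not_irreducible_of_frobeniusTrace_congr_off_finite V 3 S hSfin ?_ hIrr
  intro ℓ _ hℓS hℓ3 hgood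
  by_contra h3
  have hℓ : ℓ.Prime := Fact.out
  -- `ℓ` is prime to the level
  have hℓN : ¬ ℓ ∣ N := hℓS
  have hℓDMC : ¬ ℓ ∣ D * M * ∏ p ∈ C, p := by
    intro h
    apply hℓN
    rw [← hDMC]
    exact h.trans (mul_dvd_mul_left _ (Finset.prod_dvd_prod_of_dvd _ _ fun p _ => dvd_pow_self p two_ne_zero))
  have hqℓ : ¬ q ∣ ℓ := by
    intro h
    have hqp : q.Prime := Fact.out
    have hql : q = ℓ := (Nat.prime_dvd_prime_iff_eq hqp hℓ).mp h
    apply hℓDMC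
    rw [← hql]
    exact dvd_mul_of_dvd_right (Finset.dvd_prod_of_mem (fun p : ℕ => p) hq) (D * M)
  -- the Hecke data at `ℓ`
  obtain ⟨hfin, hcard⟩ := hHD D M C X ℓ hℓ hℓDMC
  letI : Fintype (Quotient (X.heckeSetoid ℓ)) := Fintype.ofFinite _
  have hcard' : Fintype.card (Quotient (X.heckeSetoid ℓ)) = ℓ + 1 := by rw [← Nat.card_eq_fintype_card, hcard]
  set a : ℤ := W₁.LFunction ℓ with hadef
  have hhecke : X.heckeFun ℓ Q.form = fun τ => ((a : ℤ) : ℂ) * Q.form τ := Q.hecke_eq ℓ hℓ hℓDMC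
  -- `a = a_ℓ(V)`
  have haV : a = V.frobeniusTrace ℓ := by
    rw [hadef, ← LFunction_eq_of_isIsogenous_holds V W₁ hQ.1, V.LFunction_apply_prime_eq_frobeniusTrace ℓ hgood]
  have h3' : ¬ (3 : ℤ) ∣ ((ℓ : ℤ) + 1 - a) := by
    intro h
    apply h3
    rw [← haV]
    have : a - ((ℓ : ℤ) + 1) = -(((ℓ : ℤ) + 1 - a)) := by ring
    rw [show ((3 : ℕ) : ℤ) = 3 by norm_num, this]
    exact (dvd_neg).mpr h
  -- the subgroup `3Λ`
  set N₃ : AddSubgroup ℂ := Q.L.lattice.toAddSubgroup.map (AddMonoidHom.mulLeft (3 : ℂ)) with hN₃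
  have hmemN₃ : ∀ {x : ℂ}, x ∈ N₃ ↔ ∃ y ∈ Q.L.lattice, x = 3 * y := by
    intro x
    rw [hN₃, AddSubgroup.mem_map]
    constructor
    · rintro ⟨y, hy, rfl⟩; exact ⟨y, hy, rfl⟩
    · rintro ⟨y, hy, rfl⟩; exact ⟨y, hy, rfl⟩
  -- (1) `Γ̄(q)`-periods of `F` lie in `3Λ`
  have hN : ∀ g ∈ principalLevel X q, ∀ z : ℍ, segmentIntegral Q.form z (g • z) ∈ N₃ := by
    intro g hg z
    obtain ⟨y, hy, hyeq⟩ := periods_mem_of_dockedVector_eq R hq Q.form Q.L.lattice Q.period_mem w hw hg z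
    exact hmemN₃.mpr ⟨y, hy, hyeq⟩
  -- (2)+(3) every `Γ`-period of `F` lies in `3Λ`
  have hper3 : ∀ γ ∈ X.Gamma, ∀ z : ℍ, ∃ x ∈ Q.L.lattice, segmentIntegral Q.form z (γ • z) = ((3 : ℕ) : ℂ) * x := by
    intro γ hγ z
    obtain ⟨e, δ, hδ, hδeq⟩ := HeckePeriod.exists_perm_mul X ℓ hγ
    have h1 := HeckePeriod.period_smul_eq_sum X ℓ Q.form ((a : ℤ) : ℂ) hhecke e δ hδ hδeq z
    have h2 := Eisenstein.card_smul_period_sub_sum_mem R ℓ hqℓ Q.form N₃ hN hγ e δ hδ hδeq z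
    rw [hcard'] at h2
    have h12 : (((ℓ : ℤ) + 1 - a : ℤ) : ℂ) * segmentIntegral Q.form z (γ • z) ∈ N₃ := by
      have e : (((ℓ : ℤ) + 1 - a : ℤ) : ℂ) * segmentIntegral Q.form z (γ • z) =
          (((ℓ + 1 : ℕ) : ℂ) * segmentIntegral Q.form z (γ • z) - ∑ i, segmentIntegral Q.form z (δ i • z))
            - (((a : ℤ) : ℂ) * segmentIntegral Q.form z (γ • z) - ∑ i, segmentIntegral Q.form z (δ i • z)) := by
        push_cast; ring
      rw [e]
      refine N₃.sub_mem h2 ?_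
      rw [h1, sub_self]
      exact N₃.zero_mem
    obtain ⟨y, hy, hyeq⟩ := hmemN₃.mp h12
    obtain ⟨x', hx', hxeq⟩ := exists_eq_three_mul_of_coprime Q.L.lattice (Q.period_mem γ hγ z) hy h3' hyeq
    exact ⟨x', hx', by rw [hxeq]; push_cast; ring⟩
  -- (4) contradiction with class-minimality
  obtain ⟨Q', hQ'⟩ := hISO D M C X W₁ Q 3 (by norm_num) hper3
  have hle : Q.deg ≤ Q'.deg := hQ.2 W₁ Q' hQ.1
  have hpos : 0 < Q'.deg := Q'.deg_pos
  omega

end Summit.BirchSwinnertonDyer.BirchSwinnertonDyer.Theorems.CartanCover.Descent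

end
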